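import Mathlib.LinearAlgebra.Matrix.Transvection
import Mathlib.LinearAlgebra.Matrix.ToLin
import Mathlib.LinearAlgebra.Determinant
import Mathlib.LinearAlgebra.Dual.Defs
import HarnessLib

/-!
# The general linear group is generated by dilations (axial homologies)

Generic linear algebra over a field `K` with `2 ≠ 0`, for a finite-dimensional `K`-space `U`:

* `dilation φ e z : U →ₗ[K] U`, `x ↦ x + (z - 1) φ(x) e` — for `φ(e) = 1` and `z ≠ 0` the
  **dilation** (axial homology) with axis the hyperplane `ker φ`, centre the line `K e`, and ratio
  `z` (it is `z` on `e` and the identity on `ker φ`);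
* `exists_eq_prod_dilations`: every `G ∈ End(U)` with `det G ≠ 0` is a product of dilations
  `dilation φᵢ eᵢ zᵢ` with `φᵢ(eᵢ) = 1`, `zᵢ ≠ 0` (J. Dieudonné, *La géométrie des groupes
  classiques* (1955), Ch. II §1: `GL_n(K)` is generated by dilations for `K ≠ 𝔽₂`; here from
  Mathlib's pivot decomposition `M = T₁ ⋯ T_p · D · T'₁ ⋯ T'_q`
  (`Matrix.Pivot.exists_list_transvec_mul_diagonal_mul_list_transvec`): a diagonal matrix is a
  product of dilations along the basis vectors, and a transvection `1 + c E_{ij}` is the product of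
  the two dilations `dilation βⱼ^* βⱼ 2⁻¹` and `dilation βⱼ^* (βⱼ + c βᵢ) 2`).

Purpose: the integration step of the tree's elementary proof of Zarhin's theorem on the Hodge
group of a Hodge structure of K3 type in the CM case (Huybrechts, *Lectures on K3 Surfaces*,
Thm. 3.3.9: `Hdg(T) = U(T, Ψ)`), where an element of the unitary group acts on `V_ℂ` through
`GL(V_σ)` and its contragredient on `V_σ̄`: a dilation of `V_σ` extended contragrediently is a
hyperbolic rotation of `OrthogonalRotationGeneration.lean` with `e ∈ V_σ`, `f ∈ V_σ̄`, and those
fix every tensor killed by their generators (`OrthogonalRotationTensorInvariance.lean`). No named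
facts; the only definition is `dilation`.

## References

* J. Dieudonné, *La géométrie des groupes classiques*, Springer (1955), Ch. II §1.
* E. Artin, *Geometric Algebra*, Interscience (1957), Ch. IV §1 (`GL` and dilations).
* D. Huybrechts, *Lectures on K3 Surfaces*, CUP (2016), Thm. 3.3.9.
-/

noncomputable section

namespace Literature.AlgebraicGeometry.Motives

namespace OrthogonalGeneration

universe u v

variable {K : Type u} [Field K] {U : Type v} [AddCommGroup U] [Module K U]

/-! ### Dilations -/

/-- The **dilation** `x ↦ x + (z - 1) φ(x) e`: for `φ(e) = 1`, `z ≠ 0` the axial homology of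
ratio `z` with centre `K e` and axis `ker φ` (Dieudonné, *La géométrie des groupes classiques*,
Ch. II §1). For `φ(e) ≠ 1` or `z = 0` the formula still defines a linear map (documented junk).
[folklore] -/
def dilation (φ : Module.Dual K U) (e : U) (z : K) : Module.End K U :=
  1 + (z - 1) • φ.smulRight e

/-- The dilation as a formula. [folklore] -/
theorem dilation_apply (φ : Module.Dual K U) (e : U) (z : K) (x : U) :
    dilation φ e z x = x + ((z - 1) * φ x) • e := by
  simp [dilation, mul_smul]

/-- `dilation φ e z e = z e` when `φ(e) = 1`. [folklore] -/
theorem dilation_apply_center {φ : Module.Dual K U} {e : U} (h : φ e = 1) (z : K) :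
    dilation φ e z e = z • e := by
  rw [dilation_apply, h, mul_one, sub_smul, one_smul, add_sub_cancel]

/-- A dilation is the identity on its axis `ker φ`. [folklore] -/
theorem dilation_apply_of_eq_zero (φ : Module.Dual K U) (e : U) (z : K) {x : U} (hx : φ x = 0) :
    dilation φ e z x = x := by
  rw [dilation_apply, hx, mul_zero, zero_smul, add_zero]

/-- `dilation φ e 1 = 1`. [folklore] -/
theorem dilation_one (φ : Module.Dual K U) (e : U) : dilation φ e 1 = 1 := by
  ext x
  rw [dilation_apply, sub_self, zero_mul, zero_smul, add_zero, Module.End.one_apply]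

/-! ### Matrices of transvections and diagonal matrices as products of dilations -/

section Basis

variable {n : Type*} [Fintype n] [DecidableEq n] (β : Module.Basis n K U)

/-- In a basis `β`, the diagonal matrix `diag D` acts as the (commuting) product of the dilations
`dilation βₖ^* βₖ (D k)`. [folklore] -/
theorem toLin_diagonal_eq_prod_dilations (D : n → K) (l : List n) (hl : l.Nodup)
    (hl' : ∀ k, k ∈ l) :
    Matrix.toLin β β (Matrix.diagonal D) =
      (l.map fun k => dilation (β.coord k) (β k) (D k)).prod := by
  refine β.ext fun k => ?_
  rw [Matrix.toLin_self, Finset.sum_eq_single k (fun j _ hjk => by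
      rw [Matrix.diagonal_apply_ne _ hjk, zero_smul]) (fun h => absurd (Finset.mem_univ k) h),
    Matrix.diagonal_apply_eq]
  -- the word of dilations multiplies `β k` by `D k` (only the `k`-th letter acts)
  have key : ∀ (l : List n), l.Nodup →
      (l.map fun k => dilation (β.coord k) (β k) (D k)).prod (β k) =
        if k ∈ l then D k • β k else β k := by
    intro l hl
    induction l with
    | nil => simp
    | cons j l ih =>
      rw [List.nodup_cons] at hl
      rw [List.map_cons, List.prod_cons, Module.End.mul_apply, ih hl.2]
      by_cases hk : k ∈ l
      · have hjk : j ≠ k := fun h => hl.1 (h ▸ hk)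
        rw [if_pos hk, if_pos (List.mem_cons_of_mem j hk), map_smul,
          dilation_apply_of_eq_zero _ _ _ (by simp [hjk.symm])]
      · rw [if_neg hk]
        by_cases hjk : j = k
        · subst hjk
          rw [if_pos List.mem_cons_self, dilation_apply_center (by simp)]
        · rw [if_neg (by simp [hk, Ne.symm hjk]), dilation_apply_of_eq_zero _ _ _ (by simp [Ne.symm hjk])]
  rw [key l hl, if_pos (hl' k)]

/-- In a basis `β`, the matrix `1 + c E_{ij}` (a transvection when `i ≠ j`) acts as
`x ↦ x + c βⱼ^*(x) βᵢ`. [folklore] -/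
theorem toLin_transvection_apply (i j : n) (c : K) (x : U) :
    Matrix.toLin β β (Matrix.transvection i j c) x = x + (c * β.coord j x) • β i := by
  have key : ∀ k, Matrix.toLin β β (Matrix.transvection i j c) (β k) =
      β k + (c * β.coord j (β k)) • β i := by
    intro k
    rw [Matrix.transvection, Matrix.toLin_self]
    simp only [Matrix.add_apply, Matrix.one_apply, add_smul, Finset.sum_add_distrib]
    rw [Finset.sum_eq_single k (fun l _ hlk => by rw [if_neg hlk, zero_smul])
      (fun h => absurd (Finset.mem_univ k) h), if_pos rfl, one_smul]
    congr 1
    rw [Finset.sum_eq_single i (fun l _ hli => by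
      rw [Matrix.single_apply_of_row_ne (Ne.symm hli), zero_smul])
      (fun h => absurd (Finset.mem_univ i) h)]
    by_cases hjk : j = k
    · subst hjk
      rw [Matrix.single_apply_same, Module.Basis.coord_apply, Module.Basis.repr_self,
        Finsupp.single_eq_same, mul_one]
    · rw [Matrix.single_apply_of_col_ne _ _ hjk, Module.Basis.coord_apply, Module.Basis.repr_self,
        Finsupp.single_eq_of_ne hjk, mul_zero, zero_smul]
  -- extend from the basis by linearity
  have hlin : Matrix.toLin β β (Matrix.transvection i j c) =
      1 + c • (β.coord j).smulRight (β i) := by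
    refine β.ext fun k => ?_
    rw [key]
    simp [mul_smul]
  rw [hlin]
  simp [mul_smul]

/-- **A transvection is a product of two dilations** (`2 ≠ 0`):
`1 + c E_{ij} = dilation βⱼ^* βⱼ 2⁻¹ * dilation βⱼ^* (βⱼ + c βᵢ) 2`. [folklore] -/
theorem toLin_transvection_eq_dilation_mul_dilation [NeZero (2 : K)] {i j : n} (hij : i ≠ j)
    (c : K) :
    Matrix.toLin β β (Matrix.transvection i j c) =
      dilation (β.coord j) (β j) 2⁻¹ * dilation (β.coord j) (β j + c • β i) 2 := by
  have h2 : (2 : K) ≠ 0 := NeZero.ne 2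
  have hji : β.coord j (β i) = 0 := by simp [hij.symm]
  have hjj : β.coord j (β j) = 1 := by simp
  refine LinearMap.ext fun x => ?_
  rw [toLin_transvection_apply β i j, Module.End.mul_apply, dilation_apply, dilation_apply]
  simp only [map_add, map_smul, smul_eq_mul, hjj, hji, mul_one, mul_zero, add_zero]
  -- compare coefficients of `x`, `β j`, `β i`
  have hc1 : (2 - 1 : K) * β.coord j x = β.coord j x := by ring
  rw [hc1, smul_add, smul_smul, add_assoc]
  congr 1
  rw [show ((2⁻¹ - 1) * (β.coord j x + β.coord j x)) • β j =
      -(β.coord j x • β j) by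
    rw [← two_mul, show ((2 : K)⁻¹ - 1) * (2 * β.coord j x) = -β.coord j x by field_simp; ring,
      neg_smul]]
  rw [mul_comm (β.coord j x) c]
  abel

end Basis

/-! ### Main theorem -/

/-- The linear map of a product of matrices is the product of the linear maps. [folklore] -/
theorem toLin_list_prod {n : Type*} [Fintype n] [DecidableEq n] (β : Module.Basis n K U)
    (L : List (Matrix n n K)) :
    Matrix.toLin β β L.prod = (L.map (Matrix.toLin β β)).prod := by
  induction L with
  | nil => rw [List.prod_nil, Matrix.toLin_one, List.map_nil, List.prod_nil]; rfl
  | cons M L ih =>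
    rw [List.prod_cons, Matrix.toLin_mul β β β, ih, List.map_cons, List.prod_cons]
    rfl

/-- **`GL(U)` is generated by dilations** (`2 ≠ 0` in `K`): every endomorphism `G` of the
finite-dimensional space `U` with `det G ≠ 0` is a product of dilations `dilation φᵢ eᵢ zᵢ` with
`φᵢ(eᵢ) = 1` and `zᵢ ≠ 0` (Dieudonné, *La géométrie des groupes classiques*, Ch. II §1; via the
pivot decomposition into transvections and a diagonal matrix, a transvection being a product of
two dilations and a diagonal matrix a product of dilations along the basis vectors). [folklore] -/
theorem exists_eq_prod_dilations [NeZero (2 : K)] [FiniteDimensional K U] (G : Module.End K U)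
    (hG : LinearMap.det G ≠ 0) :
    ∃ L : List (Module.Dual K U × U × K),
      (∀ d ∈ L, d.1 d.2.1 = 1 ∧ d.2.2 ≠ 0) ∧ G = (L.map fun d => dilation d.1 d.2.1 d.2.2).prod := by
  classical
  have h2 : (2 : K) ≠ 0 := NeZero.ne 2
  set β := Module.finBasis K U with hβ
  set M := LinearMap.toMatrix β β G with hM
  obtain ⟨T, T', D, hMeq⟩ := Matrix.Pivot.exists_list_transvec_mul_diagonal_mul_list_transvec M
  -- the diagonal entries are non-zero
  have hD : ∀ k, D k ≠ 0 := by
    have hdet : M.det = ∏ k, D k := by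
      rw [hMeq, Matrix.det_mul, Matrix.det_mul, Matrix.TransvectionStruct.det_toMatrix_prod,
        Matrix.TransvectionStruct.det_toMatrix_prod, Matrix.det_diagonal, one_mul, mul_one]
    have hdet' : M.det ≠ 0 := by rwa [hM, LinearMap.det_toMatrix]
    rw [hdet] at hdet'
    exact fun k hk => hdet' (Finset.prod_eq_zero (Finset.mem_univ k) hk)
  -- dilation words for transvections and for the diagonal part
  have htrans : ∀ t : Matrix.TransvectionStruct (Fin (Module.finrank K U)) K,
      ∃ L : List (Module.Dual K U × U × K), (∀ d ∈ L, d.1 d.2.1 = 1 ∧ d.2.2 ≠ 0) ∧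
        Matrix.toLin β β t.toMatrix = (L.map fun d => dilation d.1 d.2.1 d.2.2).prod := by
    intro t
    refine ⟨[(β.coord t.j, β t.j, 2⁻¹), (β.coord t.j, β t.j + t.c • β t.i, 2)], ?_, ?_⟩
    · intro d hd
      simp only [List.mem_cons, List.mem_nil_iff, or_false] at hd
      rcases hd with rfl | rfl
      · exact ⟨by simp, inv_ne_zero h2⟩
      · exact ⟨by simp [t.hij.symm], h2⟩
    · rw [Matrix.TransvectionStruct.toMatrix, toLin_transvection_eq_dilation_mul_dilation β t.hij]
      simp
  have htransL : ∀ Ts : List (Matrix.TransvectionStruct (Fin (Module.finrank K U)) K),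
      ∃ L : List (Module.Dual K U × U × K), (∀ d ∈ L, d.1 d.2.1 = 1 ∧ d.2.2 ≠ 0) ∧
        Matrix.toLin β β (Ts.map Matrix.TransvectionStruct.toMatrix).prod =
          (L.map fun d => dilation d.1 d.2.1 d.2.2).prod := by
    intro Ts
    induction Ts with
    | nil =>
      refine ⟨[], by simp, ?_⟩
      rw [List.map_nil, List.prod_nil, Matrix.toLin_one, List.map_nil, List.prod_nil]
      rfl
    | cons t Ts ih =>
      obtain ⟨L₁, hL₁, h₁⟩ := htrans t
      obtain ⟨L₂, hL₂, h₂⟩ := ih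
      refine ⟨L₁ ++ L₂, fun d hd => ?_, ?_⟩
      · rcases List.mem_append.1 hd with hd | hd
        exacts [hL₁ d hd, hL₂ d hd]
      · rw [List.map_cons, List.prod_cons, Matrix.toLin_mul β β β, h₁, h₂, List.map_append,
          List.prod_append]
        rfl
  have hdiag : ∃ L : List (Module.Dual K U × U × K), (∀ d ∈ L, d.1 d.2.1 = 1 ∧ d.2.2 ≠ 0) ∧
      Matrix.toLin β β (Matrix.diagonal D) = (L.map fun d => dilation d.1 d.2.1 d.2.2).prod := by
    refine ⟨(List.finRange (Module.finrank K U)).map fun k => (β.coord k, β k, D k), ?_, ?_⟩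
    · intro d hd
      obtain ⟨k, -, rfl⟩ := List.mem_map.1 hd
      exact ⟨by simp, hD k⟩
    · rw [toLin_diagonal_eq_prod_dilations β D (List.finRange _) (List.nodup_finRange _)
        (List.mem_finRange), List.map_map]
      rfl
  obtain ⟨L₁, hL₁, h₁⟩ := htransL T
  obtain ⟨L₂, hL₂, h₂⟩ := hdiag
  obtain ⟨L₃, hL₃, h₃⟩ := htransL T'
  refine ⟨L₁ ++ L₂ ++ L₃, fun d hd => ?_, ?_⟩
  · rcases List.mem_append.1 hd with hd | hd
    · rcases List.mem_append.1 hd with hd | hd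
      exacts [hL₁ d hd, hL₂ d hd]
    · exact hL₃ d hd
  · have hG' : G = Matrix.toLin β β M := by rw [hM, Matrix.toLin_toMatrix]
    rw [hG', hMeq, Matrix.toLin_mul β β β, Matrix.toLin_mul β β β, h₁, h₂, h₃, List.map_append,
      List.map_append, List.prod_append, List.prod_append]
    rfl

end OrthogonalGeneration

end Literature.AlgebraicGeometry.Motives

end
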